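import Mathlib
import Summits.KontsevichZagierPeriods.Zeta5Search.Elimination.PairEnvelope
import Summits.KontsevichZagierPeriods.Zeta5Search.Denom.ElimProductRule
import HarnessLib

/-!
# Cross-family pair elimination of `ζ(3)`: the no-go in one statement (P1 of `FAMILY.md`, T4)

systematic search; no irrationality claim unless certified.

Cell `pub-zeta5`, class `elim` (two-family combinations eliminating `ζ(3)`), `families/elim/FAMILY.md` §4 P1 /
§6.  This file JOINS the two halves already in the tree —
`Elimination/PairEnvelope.lean` (rates of the cross-family eliminant `w_G r_F − w_F r_G`, `margin_le_mean`) and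
`Denom/ElimProductRule.lean` (product rule for the denominators of the eliminated form) — into the packaged
no-go statement of the class:

* `pairMultiplier`, `pairMultiplier_clears`, `cleared_elim_integral`, `cleared_eliminant_eq` — clearing the
  eliminated form by the PRODUCT-RULE multiplier `K = lcm(lcm(D^F_u D^G_w, D^F_w D^G_u), lcm(D^F_v D^G_w, D^F_w D^G_v))`
  gives an INTEGER form `A·ξ + B` (the `ζ(3)`-coefficient is exactly `0`);
* `cleared_eliminant_rateGE` — its lower exponential rate is `δ + (b_G − c_F)` (`δ` = rate of `K`, dominant product
  `w_G r_F`; no cancellation under the rate gap, `eliminant_rateGE`);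
* `not_tendsto_zero_of_rateGE_pos` — a sequence with positive lower rate does not tend to `0`;
* `pair_no_go` — **if the mean of the two Fischler–Zudilin exponents `c_X − b_X − δ_{vX} − δ_{wX}` is negative
  (it is for every pair of families in print and in the census) and the product-rule multiplier has rate at least
  `max(δ_{wG}+δ_{vF}, δ_{wF}+δ_{vG})`, the cleared cross-family eliminant has POSITIVE lower rate and does NOT tend
  to zero** — so no cross-family pair `(F, G)` with exact rates and a rate gap yields an irrationality certificate
  for `ξ = ζ(5)` by eliminating `η = ζ(3)`.  (Equal rates / cancellation is the intra-family minor road, E0, not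
  this theorem.)

Hypotheses are the abstract rate predicates `RateLE` / `RateGE` of `PairEnvelope.lean`; nothing here is a cited
fact, nothing is specific to one family, and nothing is claimed about `ζ(5)`.
-/

namespace Summit.KontsevichZagierPeriods.Zeta5Search.Elimination

open Filter Topology Finset
open Summit.KontsevichZagierPeriods.Zeta5Search.Denom

/-! ### 1. Clearing the eliminated form by the product rule -/

/-- The PRODUCT-RULE multiplier for a pair of three-term coefficient vectors indexed by `Fin 3`
(`0 ↔ ξ = ζ(5)`, `1 ↔ η = ζ(3)` (eliminated), `2 ↔` constant term), with per-coordinate denominators `DF`, `DG`. -/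
def pairMultiplier (DF DG : Fin 3 → ℕ) : ℕ :=
  Nat.lcm (Nat.lcm (DF 0 * DG 1) (DF 1 * DG 0)) (Nat.lcm (DF 2 * DG 1) (DF 1 * DG 2))

/-- The product-rule multiplier clears EVERY coefficient of the eliminated form `elimCoeff a b 1`
(`Denom.elimCoeff_dInt'` coordinate by coordinate; the eliminated coordinate is `0`). -/
theorem pairMultiplier_clears {DF DG : Fin 3 → ℕ} {a b : Fin 3 → ℚ}
    (ha : ∀ k, a k ∈ dInt (DF k)) (hb : ∀ k, b k ∈ dInt (DG k)) :
    ∀ k, elimCoeff a b 1 k ∈ dInt (pairMultiplier DF DG) := by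
  intro k
  fin_cases k
  · exact DInt.mono (Nat.dvd_lcm_left _ _) (elimCoeff_dInt' ha hb 1 0)
  · rw [show ((⟨1, by norm_num⟩ : Fin 3)) = 1 from rfl, elimCoeff_self]
    exact DInt.zero _
  · exact DInt.mono (Nat.dvd_lcm_right _ _) (elimCoeff_dInt' ha hb 1 2)

/-- Integer coefficients of the cleared eliminated form; the `η`-coefficient is `0`. -/
theorem cleared_elim_integral {DF DG : Fin 3 → ℕ} {a b : Fin 3 → ℚ}
    (ha : ∀ k, a k ∈ dInt (DF k)) (hb : ∀ k, b k ∈ dInt (DG k)) :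
    ∃ z : Fin 3 → ℤ, (∀ k, ((pairMultiplier DF DG : ℕ) : ℚ) * elimCoeff a b 1 k = z k) ∧ z 1 = 0 := by
  choose z hz using fun k => mem_dInt.1 (pairMultiplier_clears ha hb k)
  refine ⟨z, hz, ?_⟩
  have h1 := hz 1
  rw [elimCoeff_self, mul_zero] at h1
  exact_mod_cast h1.symm

/-- **The cleared cross-family eliminant is an INTEGER form in `ξ` and `1` alone.**  For the two three-term
forms `r_F = a₀ξ + a₁η + a₂`, `r_G = b₀ξ + b₁η + b₂` (`a₁ = w_F`, `b₁ = w_G`):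
`K · (w_G r_F − w_F r_G) = A ξ + B` with `A, B ∈ ℤ`, `K` the product-rule multiplier. -/
theorem cleared_eliminant_eq {DF DG : Fin 3 → ℕ} {a b : Fin 3 → ℚ}
    (ha : ∀ k, a k ∈ dInt (DF k)) (hb : ∀ k, b k ∈ dInt (DG k)) (ξ η : ℝ) :
    ∃ A B : ℤ, ((pairMultiplier DF DG : ℕ) : ℝ) *
        ((b 1 : ℝ) * ((a 0 : ℝ) * ξ + (a 1 : ℝ) * η + (a 2 : ℝ)) -
          (a 1 : ℝ) * ((b 0 : ℝ) * ξ + (b 1 : ℝ) * η + (b 2 : ℝ))) = (A : ℝ) * ξ + (B : ℝ) := by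
  obtain ⟨z, hz, -⟩ := cleared_elim_integral ha hb
  refine ⟨z 0, z 2, ?_⟩
  have h0 : ((z 0 : ℤ) : ℝ) = ((pairMultiplier DF DG : ℕ) : ℝ) * ((a 0 : ℝ) * (b 1 : ℝ) - (a 1 : ℝ) * (b 0 : ℝ)) := by
    have h := congrArg (fun q : ℚ => (q : ℝ)) (hz 0)
    simp only [elimCoeff] at h
    push_cast at h
    linarith
  have h2 : ((z 2 : ℤ) : ℝ) = ((pairMultiplier DF DG : ℕ) : ℝ) * ((a 2 : ℝ) * (b 1 : ℝ) - (a 1 : ℝ) * (b 2 : ℝ)) := by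
    have h := congrArg (fun q : ℚ => (q : ℝ)) (hz 2)
    simp only [elimCoeff] at h
    push_cast at h
    linarith
  rw [h0, h2]
  ring

/-! ### 2. Rates of the cleared eliminant -/

/-- Lower rate of the cleared eliminant: `δ + (β_G + ρ_F)` (`δ` = lower rate of the multiplier, dominant product
`w_G r_F`, the other product exponentially smaller — `PairEnvelope.eliminant_rateGE`). -/
theorem cleared_eliminant_rateGE {K rF wF rG wG : ℕ → ℝ} {δ ρF βF ρG βG : ℝ}
    (hK : RateGE K δ) (hrF : RateGE rF ρF) (hwG : RateGE wG βG) (hwF : RateLE wF βF) (hrG : RateLE rG ρG)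
    (hgap : βF + ρG < βG + ρF) :
    RateGE (fun n => K n * (wG n * rF n - wF n * rG n)) (δ + (βG + ρF)) :=
  rateGE_mul hK (eliminant_rateGE hrF hwG hwF hrG hgap)

/-- A sequence with POSITIVE lower exponential rate does not tend to `0`. -/
theorem not_tendsto_zero_of_rateGE_pos {x : ℕ → ℝ} {a : ℝ} (hx : RateGE x a) (ha : 0 < a) :
    ¬ Tendsto x atTop (𝓝 0) := by
  intro h
  have h1 : ∀ᶠ n : ℕ in atTop, Real.exp ((a - a / 2) * n) ≤ |x n| := hx (a / 2) (by linarith)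
  have h0 : Tendsto (fun n => |x n|) atTop (𝓝 0) := by simpa using h.abs
  have h2 : ∀ᶠ n : ℕ in atTop, |x n| < 1 := Tendsto.eventually_lt_const zero_lt_one h0
  obtain ⟨n, hn1, hn2⟩ := (h1.and h2).exists
  have hnn : (0 : ℝ) ≤ (a - a / 2) * n := mul_nonneg (by linarith) (Nat.cast_nonneg n)
  have h3 : (1 : ℝ) ≤ Real.exp ((a - a / 2) * n) := by
    have := Real.add_one_le_exp ((a - a / 2) * n)
    linarith
  linarith

/-! ### 3. The no-go of the class, packaged (P1 of `FAMILY.md`; T4) -/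

/-- **PAIR NO-GO (P1).**  Two families `F`, `G` of three-term forms with decay rates `c_F, c_G` (exact lower rate for
`r_F`), `ζ(3)`-coefficient growth `b_F, b_G` (exact lower rate for `w_G`), the dominant product being `w_G r_F`
(`b_F − c_G < b_G − c_F`; otherwise swap the names), cleared by a multiplier `K` of rate at least the product-rule
rate `max(δ_{wG}+δ_{vF}, δ_{wF}+δ_{vG})`.  If the MEAN of the two Fischler–Zudilin exponents
`c_X − b_X − δ_{vX} − δ_{wX}` is negative, then the cleared eliminant `K (w_G r_F − w_F r_G)` has the positive lower
rate `δ + b_G − c_F` and does not tend to `0`: the pair gives no irrationality certificate.  (`margin_le_mean`: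
`min(c_F − b_G, c_G − b_F) − max(…) ≤` mean.) -/
theorem pair_no_go {K rF wF rG wG : ℕ → ℝ} {cF bF δvF δwF cG bG δvG δwG δ : ℝ}
    (hrF : RateGE rF (-cF)) (hwG : RateGE wG bG) (hwF : RateLE wF bF) (hrG : RateLE rG (-cG))
    (hgap : bF - cG < bG - cF)
    (hK : RateGE K δ) (hδ : max (δwG + δvF) (δwF + δvG) ≤ δ)
    (hmean : ((cF - bF - δvF - δwF) + (cG - bG - δvG - δwG)) / 2 < 0) :
    RateGE (fun n => K n * (wG n * rF n - wF n * rG n)) (δ + (bG - cF)) ∧ 0 < δ + (bG - cF) ∧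
      ¬ Tendsto (fun n => K n * (wG n * rF n - wF n * rG n)) atTop (𝓝 0) := by
  have hrate : RateGE (fun n => K n * (wG n * rF n - wF n * rG n)) (δ + (bG + -cF)) :=
    cleared_eliminant_rateGE hK hrF hwG hwF hrG (by linarith)
  have hrate' : RateGE (fun n => K n * (wG n * rF n - wF n * rG n)) (δ + (bG - cF)) := by
    simpa [sub_eq_add_neg] using hrate
  have hpos : 0 < δ + (bG - cF) := by
    have hm := margin_le_mean cF bF δvF δwF cG bG δvG δwG
    have hmin : min (cF - bG) (cG - bF) = cF - bG := min_eq_left (by linarith)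
    rw [hmin] at hm
    have hmax := hδ
    linarith
  exact ⟨hrate', hpos, not_tendsto_zero_of_rateGE_pos hrate' hpos⟩

end Summit.KontsevichZagierPeriods.Zeta5Search.Elimination
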